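import Summits.BirchSwinnertonDyer.Rank1Residual.P2.KrizLiTwoFortyThreeIsogenyClass
import Summits.BirchSwinnertonDyer.Rank1Residual.WAll.TargetCMTwoInertKrizLiTwoFortyThree
import Summits.BirchSwinnertonDyer.Rank1Residual.Additive.GordIsogenyInvariance
import Literature.NumberTheory.EllipticCurves.LeadingTermBSZOrdinaryProofs
import HarnessLib

/-!
# Cell `bsd-print-cf2` (D-0131 (2) PRINT TIER, leaf CornerF @ `p = 2`), prover p3 — PLACEMENT of the
# Kriz–Li `243a1` family in the INERT-GOOD cell: every member has GOOD reduction at `2`, IN THE KERNEL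

HONEST FRAMING. Companion of `P2/KrizLiTwoFortyThree{Curve,Slices,IsogenyClass,Membership}.lean` and of
`WAll/TargetCMTwoInertKrizLiTwoFortyThree.lean`. Nothing asserted, no named fact. For `d ∈ 𝒩` (so
`d ≡ 1 (mod 4)`, and then also `−23d ≡ 1 (mod 4)`) the twist `243a1^{(e)}`, `e ∈ {d, −23d}`, has the
INTEGRAL model `y² + y = x³ − (3e³ + 1)/4` with discriminant `−3⁵e⁶`, odd: so every `ℚ`-model, and (good
reduction being an isogeny invariant, Silverman VII.7.2 — a tree theorem) every curve `ℚ`-isogenous to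
it, has good reduction at `2`. Consequences: the leaf `WAllCornerFTwoInertKrizLiTwoFortyThree` is a slice
of p4's INERT-GOOD slice `WAllCornerFTwoInertGood` alone (row 12₂ cell «inert, good (supersingular) at
2»; crux 20671's registered stub `stub_inertJZero_goodAtTwo`), disjoint in the kernel from the Shu–Zhai
`36a1` family (all of whose members are BAD at `2`, p536988 `not_good_two_of_smul_twist36`).

References: [KrizLi2019] Def 4.1 (`d ≡ 1 (mod 4)`); [SilvermanAEC2009] VII.5 Prop. 5.1(a), Cor. VII.7.2;
tree files cited inline.
-/

noncomputable section

open WeierstrassCurve NumberField Literature.NumberTheory.EllipticCurves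
  Literature.NumberTheory.EllipticCurves.Rank1Residual
  Summit.BirchSwinnertonDyer.Rank1Residual

set_option autoImplicit false

namespace Summit.BirchSwinnertonDyer.Rank1Residual.P2

/-! ## §14 An odd-discriminant integral model of `243a1^{(e)}`, `e ≡ 1 (mod 4)` -/

/-- **The quadratic twist of `243a1` by `e` is `y² = x³ − 3e³/4`** (the tree's `quadraticTwist`:
`b₂ = b₄ = 0`, `b₆ = −3`). [folklore] -/
theorem quadraticTwist_curve243a1 (e : ℚ) :
    curve243a1.quadraticTwist e = ⟨0, 0, 0, 0, -(3 * e ^ 3) / 4⟩ := by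
  ext <;> simp [WeierstrassCurve.quadraticTwist, curve243a1, WeierstrassCurve.b₂, WeierstrassCurve.b₄,
    WeierstrassCurve.b₆]
  ring

/-- The integral model `y² + y = x³ − k` (`k = (3e³ + 1)/4`). [folklore] -/
def twistModelInt (k : ℤ) : WeierstrassCurve ℤ := ⟨0, 0, 1, 0, -k⟩

/-- `Δ(y² + y = x³ − k) = −27 (4k − 1)²`. [folklore] -/
theorem twistModelInt_Δ (k : ℤ) : (twistModelInt k).Δ = -27 * (4 * k - 1) ^ 2 := by
  simp only [twistModelInt, WeierstrassCurve.Δ, WeierstrassCurve.b₂, WeierstrassCurve.b₄, WeierstrassCurve.b₆,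
    WeierstrassCurve.b₈]
  ring

/-- **`243a1^{(e)} ≅ y² + y = x³ − (3e³ + 1)/4` over `ℚ`** when `3e³ + 1 = 4k` (i.e. `e ≡ 1 (mod 4)`):
the shift `y ↦ y + 1/2`. [cite: SilvermanAEC2009, III.1 (admissible change of variables)] -/
theorem smul_quadraticTwist_curve243a1_eq {e k : ℤ} (hk : 3 * e ^ 3 + 1 = 4 * k) :
    (⟨1, 0, 0, 2⁻¹⟩ : VariableChange ℚ) • curve243a1.quadraticTwist (e : ℚ) = (twistModelInt k).baseChange ℚ := by
  have hkQ : (3 : ℚ) * (e : ℚ) ^ 3 + 1 = 4 * (k : ℚ) := by exact_mod_cast hk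
  rw [quadraticTwist_curve243a1]
  ext <;> simp [twistModelInt, WeierstrassCurve.baseChange, WeierstrassCurve.map, variableChange_a₁,
    variableChange_a₂, variableChange_a₃, variableChange_a₄, variableChange_a₆]
  linear_combination (-1 / 4 : ℚ) * hkQ

/-- For `e ≡ 1 (mod 4)`, `3e³ + 1` is divisible by `4` and the resulting `4k − 1 = 3e³` is odd, so
`2 ∤ Δ = −27(3e³)²`. [folklore] -/
theorem exists_k_of_emod_four {e : ℤ} (he : e % 4 = 1) : ∃ k : ℤ, 3 * e ^ 3 + 1 = 4 * k := by
  obtain ⟨m, rfl⟩ : ∃ m : ℤ, e = 4 * m + 1 := ⟨e / 4, by omega⟩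
  exact ⟨48 * m ^ 3 + 36 * m ^ 2 + 9 * m + 1, by ring⟩

/-- **Every `ℚ`-model of `243a1^{(e)}`, `e ≡ 1 (mod 4)`, has GOOD reduction at `2`** (the integral
model `y² + y = x³ − (3e³+1)/4` has odd discriminant `−3⁵e⁶`; good reduction is a `ℚ`-isomorphism
invariant). [cite: SilvermanAEC2009, VII.5 Prop. 5.1(a)] -/
theorem good_two_of_smul_twist_curve243a1 {e : ℤ} (he : e % 4 = 1) {W : WeierstrassCurve ℚ} [W.IsElliptic]
    {C : VariableChange ℚ} (hC : C • curve243a1.quadraticTwist (e : ℚ) = W) : Good W 2 := by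
  obtain ⟨k, hk⟩ := exists_k_of_emod_four he
  have he0 : (e : ℚ) ≠ 0 := by
    have : e ≠ 0 := by rintro rfl; norm_num at he
    exact_mod_cast this
  haveI := curve243a1.isElliptic_quadraticTwist he0
  -- the integral model and its odd discriminant
  have hmodel := smul_quadraticTwist_curve243a1_eq hk
  haveI : ((twistModelInt k).baseChange ℚ).IsElliptic := by rw [← hmodel]; infer_instance
  have hΔ : ¬ (2 : ℤ) ∣ (twistModelInt k).Δ := by
    rw [twistModelInt_Δ]
    have h1 : 4 * k - 1 = 3 * e ^ 3 := by linear_combination -hk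
    rw [h1]
    intro h2
    have hodd : Odd (3 * e ^ 3) := by
      have : Odd e := Int.odd_iff.mpr (by omega)
      exact (by decide : Odd (3 : ℤ)).mul (this.pow)
    have : Odd (-27 * (3 * e ^ 3) ^ 2) := (by decide : Odd (-27 : ℤ)).mul hodd.pow
    exact (Int.not_even_iff_odd.mpr this) (even_iff_two_dvd.mpr h2)
  have hgood : ((twistModelInt k).baseChange ℚ).HasGoodReductionAtPrime 2 :=
    BurungaleSkinner2023.hasGoodReductionAtPrime_baseChange_int_of_not_dvd (twistModelInt k) (p := 2)
      (by exact_mod_cast hΔ)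
  -- transport to the twist, then to `W`
  have htwist : (curve243a1.quadraticTwist (e : ℚ)).HasGoodReductionAtPrime 2 := by
    rw [← BSZLemma17.hasGoodReductionAtPrime_smul_iff _ (⟨1, 0, 0, 2⁻¹⟩ : VariableChange ℚ) 2, hmodel]
    exact hgood
  change W.HasGoodReductionAtPrime 2
  rw [← hC, BSZLemma17.hasGoodReductionAtPrime_smul_iff]
  exact htwist

/-- **Every member of the Kriz–Li family of `243a1` has GOOD reduction at `2`** (`d ∈ 𝒩` gives
`d ≡ 1 (mod 4)`, hence also `−23d ≡ 1 (mod 4)`). [cite: KrizLi2019, Def. 4.1] [cite: SilvermanAEC2009, VII.5 Prop. 5.1(a)] -/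
theorem good_two_of_isKrizLiTwoFortyThreeTwist (W : WeierstrassCurve ℚ) [W.IsElliptic]
    (hW : IsKrizLiTwoFortyThreeTwist W) : Good W 2 := by
  obtain ⟨d, C, hd, -, hC⟩ := hW
  have hd4 : d % 4 = 1 := hd.1
  rcases hC with hC | hC
  · exact good_two_of_smul_twist_curve243a1 hd4 hC
  · exact good_two_of_smul_twist_curve243a1 (e := -23 * d) (by omega) (by exact_mod_cast hC)

/-- **Every curve `ℚ`-isogenous to a Kriz–Li twist of `243a1` has GOOD reduction at `2`** (good
reduction is an isogeny invariant — Serre–Tate, Silverman Cor. VII.7.2, tree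
`IsIsogenous.hasGoodReductionAtPrime_iff`). [cite: SilvermanAEC2009, Cor. VII.7.2] -/
theorem good_two_of_isIsogenousToKrizLiTwoFortyThreeTwist (W : WeierstrassCurve ℚ) [W.IsElliptic]
    (hW : IsIsogenousToKrizLiTwoFortyThreeTwist W) : Good W 2 := by
  obtain ⟨d, hd, -, hiso⟩ := hW
  have hd4 : d % 4 = 1 := hd.1
  have hd0 : (d : ℚ) ≠ 0 := ne_zero_of_inN hd
  have key : ∀ {e : ℤ}, e % 4 = 1 → (e : ℚ) ≠ 0 → IsIsogenous W (curve243a1.quadraticTwist (e : ℚ)) →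
      Good W 2 := by
    intro e he he0 h
    haveI := curve243a1.isElliptic_quadraticTwist he0
    have h1 : (1 : VariableChange ℚ) • curve243a1.quadraticTwist (e : ℚ) = curve243a1.quadraticTwist (e : ℚ) :=
      one_smul _ _
    exact (h.hasGoodReductionAtPrime_iff 2).2 (good_two_of_smul_twist_curve243a1 he h1)
  rcases hiso with hiso | hiso
  · exact key hd4 hd0 hiso
  · exact key (e := -23 * d) (by omega) (by push_cast; exact mul_ne_zero (by norm_num) hd0)
      (by exact_mod_cast hiso)

/-! ## §15 The leaf is a slice of the INERT-GOOD slice alone -/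

/-- **`WAllCornerFTwoInertGood ⟹ WAllCornerFTwoInertKrizLiTwoFortyThree`**: the Kriz–Li `243a1`
leaf lies inside p4's inert-GOOD slice of row 12₂ (every member is good at `2`); the inert-BAD slice
is not needed. [folklore] -/
theorem wAllCornerFTwoInertKrizLiTwoFortyThree_of_inertGood (h : WAllCornerFTwoInertGood) :
    WAllCornerFTwoInertKrizLiTwoFortyThree :=
  fun W _ _ hcm hr1 hin hW ↦ h W hcm hr1 hin (good_two_of_isIsogenousToKrizLiTwoFortyThreeTwist W hW)

/-- **In the j-currency of crux 20671's registered stub `stub_inertJZero_goodAtTwo`**: the Kriz–Li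
family is a sub-class of «`r_an = 1`, `j = 0`, good at `2`» — for every member, `W.j = 0 ∧ Good W 2`.
[cite: KrizLi2019, Rem. 6.3 ("j-invariant 0")] -/
theorem j_eq_zero_and_good_two_of_isKrizLiTwoFortyThreeTwist (W : WeierstrassCurve ℚ) [W.IsElliptic]
    [W.IsGloballyMinimal] (hW : IsKrizLiTwoFortyThreeTwist W) : W.j = 0 ∧ Good W 2 := by
  refine ⟨?_, good_two_of_isKrizLiTwoFortyThreeTwist W hW⟩
  have h := (placement_of_isKrizLiTwoFortyThreeTwist W hW).2.2
  -- `cmFieldDiscrOfJ W.j = −3` with `j` of a twist of `243a1`: directly `j = 0`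
  obtain ⟨d, C, hd, -, hC⟩ := hW
  have hd0 : (d : ℚ) ≠ 0 := ne_zero_of_inN hd
  rcases hC with hC | hC
  · exact j_eq_zero_of_smul_twist_curve243a1 hd0 hC
  · exact j_eq_zero_of_smul_twist_curve243a1 (by push_cast; exact mul_ne_zero (by norm_num) hd0) hC

end Summit.BirchSwinnertonDyer.Rank1Residual.P2

end
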